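import Summits.BirchSwinnertonDyer.BirchSwinnertonDyer.Theorems.EdixhovenFibreFiveSevenStarredOptimalManinUnitFiveSevenTransportedReciprocityAllPoints
import Summits.BirchSwinnertonDyer.BirchSwinnertonDyer.Theorems.EdixhovenFibreFiveSevenStarredOptimalManinUnitFiveSevenSupersingularCellsModels
import Literature.NumberTheory.PAdicHodge.DeRhamSupersingularRamifiedCells
import Literature.NumberTheory.PAdicHodge.AinfRamifiedDivisionTransport
import Summits.BirchSwinnertonDyer.BirchSwinnertonDyer.Theorems.ManinLocalTwoThreeManinPrimeToAdditiveFiveLeBistarredKodaira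
import HarnessLib

/-!
# Kato's formula at ALL points of the GOOD `𝒪_D`-MODEL of a supersingular-cell curve over `K_{v′}` — the per-cell MODEL DATA of T5-D DISCHARGED
# (route `EdixhovenFibreFiveSeven`, crux K★ stmt-BirchSwinnertonDyer-22226, line `kato-lever`, socket `stub_localFormulaSupersingularCells` of skeleton v9;
# seat `bsd-line-edix-p1` g30, LEAD)

HONEST FRAMING. TOOL theorems only (no definition, no named fact, no instance, no `sorry`); nothing is closed; BSD / K★ / the LOC stubs are NOT
proved by this. This file does the PER-CELL INSTANTIATION of `…TransportedReciprocityAllPoints.exists_const_tatePairingPoint_eq_trace_mul_padicLog`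
(T5-D, edix-p4 g28: Kato's formula at all points of the ramified good supersingular model `E = curveFO F (W_D ⊗_ψ 𝒪_F)`): for a globally minimal
`W/ℚ` in a potentially supersingular K★ cell, a number field `K ∋ α` with `α^e = p` (`e` the cell's ramification index) and a place `v′ ∋ p` of `K`,
it CONSTRUCTS over `F = K_{v′}` the Eisenstein datum `D = (X^e − p, α)` (`EisensteinRoot.exists_poly_eq_X_pow_sub_C`), the bridge `ψ : 𝒪_D → 𝒪_F`
(`EisensteinRoot.exists_coeffToLTCoeff`), the good model `W_D = ⟨0,0,0,a ϖ^{r₄}, b ϖ^{r₆}⟩` with `(a, b) = (−27A, −54B)` from the cell numerology of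
`…SupersingularCellsModels` (`pow_dvd_c₄/c₆_of_padicValRat_j_nonneg`, `unit_identity`), the variable change `C` with
`C • (W ⊗ F) = E := curveFO F (W_D ⊗_ψ 𝒪_F)` (`exists_variableChange_eq_short`, `map_model_toF`, `AinfRamTop.curveFO_map_of_map_ψ`), and DISCHARGES
every model-side input of T5-D: `IsUnit Δ` (`AinfTop.isUnit_Δ_map_model`), Hasse `= 0` (`AinfTop.hasseCoeff_red_map_model_eq_zero`), the CM fibre
`E₀ ∈ {y² = x³ + b, y² = x³ + a x}` with `W_D ≡ E₀ (mod ϖ)` (`map_explicitModel_eq_map_cmFibre`), `p ∤ Δ(E₀)`, Hasse`(E₀) = 0`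
(`hasseCoeff_five/seven_short`), the ellipticity instances, `N = e` and (N1′) (`AinfRamTop.omegaPeriod_model_five/seven_ne_zero_of_lt` +
`AinfTop.exists_tatePtO_norm_p_lt_norm_pow_model` + `AinfRamTop.exists_omegaPeriodHomO_ne_zero`).

* ★★★ `exists_goodModel_formula_of_numerology` — generic numerology `(e, k, m, n, r₄, r₆, t₄, t₆)` as in
  `…SupersingularCellsModels.isDeRham_adicCompletion_rat_of_model_of_ramifiedCapstone`;
* ★★★ `exists_goodModel_formula_of_ssCell` — the three cells `(5; IV*) ↦ e = 3`, `(5; II*) ↦ e = 6`, `(7; III*) ↦ e = 4`.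

WHAT IS LEFT for the socket `stub_localFormulaSupersingularCells` after this file: the TRANSPORT of the displayed formula from the model `E` (a curve
over `F`, `K₀ = F`, its own Weil tower) to `W′ ⊗ F` for `W′/ℚ` along `C` and the base change `ℚ → F` (T5-E, edix-p4: `BmaxPlusTransportedReciprocityTransport`
+ all points + `log` bookkeeping), and the generic inputs displayed below (a Weil tower of `E` with its laws, a continuous additive lift `ψ` of `log χ`,
the Prop-1.2.3 binders of `V_pE|_{Γ_F}`, a line datum).

References: [Kato1993LNM1553] Ch. II Thm. 1.4.1 (3)–(4), Lemma 1.4.3; [BlochKato1990] Ex. 3.10.1, Example 3.11; [SilvermanAEC2009] VII.5.5, IV.7.5,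
Thm. IV.6.4, Prop. VII.2.1–VII.2.2; [SilvermanATAEC1994] IV Table 4.1; [Fontaine1982FormesDifferentielles] §5.
-/

set_option autoImplicit false
-- single-conjunct summit: `Summit.BirchSwinnertonDyer.BirchSwinnertonDyer.…` repeats the name by design
set_option linter.dupNamespace false

noncomputable section

open Field Function ValuativeRel WittVector NumberField IsDedekindDomain Polynomial
open scoped NumberField Topology Classical NNReal
open Literature.NumberTheory.PAdicHodge Literature.NumberTheory.GaloisRepresentations
  Literature.NumberTheory.GaloisRepresentations.IsNonarchimedeanLocalField Literature.NumberTheory.GaloisRepresentations.LubinTate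
  Literature.NumberTheory.GaloisCohomology Literature.NumberTheory.EllipticCurves Literature.NumberTheory.EllipticCurves.FormalGroupChart
  Literature.NumberTheory.PAdicHodge.GaloisContinuity Literature.IUT.LogVolume Literature.RingTheory.FormalGroups
  Literature.AlgebraicGeometry.Resolution _root_.WeierstrassCurve
  Literature.NumberTheory.EllipticCurves.Rank1Residual Literature.NumberTheory.DiophantineGeometry Rat.HeightOneSpectrum
  Summit.BirchSwinnertonDyer.Rank1Residual Summit.BirchSwinnertonDyer.Rank1Residual.Additive
  Summit.BirchSwinnertonDyer.BirchSwinnertonDyer.Theorems.StarredOptimalManinUnitFiveSevenSupersingularCellsModels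

namespace Summit.BirchSwinnertonDyer.BirchSwinnertonDyer.Theorems.StarredOptimalManinUnitFiveSevenGoodModelFormula

variable (W : WeierstrassCurve ℚ) [W.IsElliptic] [W.IsGloballyMinimal] (p : ℕ) [hp : Fact p.Prime]

set_option maxHeartbeats 1600000 in
/-- ★★★ **Kato's formula at all points of the good `𝒪_D`-model of a K★ supersingular-cell curve over `F = K_{v′}`, generic numerology.**
For `W/ℚ` globally minimal, `p ∈ {5, 7}`, `ord_p j(W) ≥ 0`, numerology `(e, k, m, n, r₄, r₆, t₄, t₆)` (`e m = 4k + r₄`, `e n = 6k + r₆`, `3r₄ = e t₄`,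
`2r₆ = e t₆`, `3m = ord_p Δ_min + t₄`, `2n = ord_p Δ_min + t₆`, `t₄ ≤ 2`, `t₆ ≤ 1`, the (N1′) inequalities and `r₆ = 0` at `5`, `r₄ = 0` at `7`), a number
field `K ∋ α`, `α^e = p`, and a place `v′ ∋ p` with the packet keys: there are an elliptic curve `E/F` and a variable change `C` over `F` with
`C • (W ⊗ F) = E` such that, for every Weil tower of `E` with its laws, every compatible `w` with `E` integral, every continuous additive lift `ψ` of
`log χ_cyclo`, the Prop-1.2.3 binders and every line datum `d` of `V_pE|_{Γ_F}`: ONE `c ∈ F` with `⟨[η], P⟩ = Tr_{F/ℚ_p}(c · exp*_d(η) · log_w P)` for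
all `η ∈ Z¹(Γ_F, T_pE)`, `P ∈ E(F)` — T5-D with its model data discharged. [cite: Kato1993LNM1553, Ch. II Thm. 1.4.1 (3)–(4), Lemma 1.4.3]
[cite: BlochKato1990, Ex. 3.10.1, Example 3.11] [cite: SilvermanAEC2009, VII.5.5 and IV.7.5] [cite: Fontaine1982FormesDifferentielles, §5] -/
theorem exists_goodModel_formula_of_numerology (hp57 : p = 5 ∨ p = 7) (hj : 0 ≤ padicValRat p W.j)
    {e k m n r₄ r₆ t₄ t₆ : ℕ} (he : 0 < e) (hem : e * m = 4 * k + r₄) (hen : e * n = 6 * k + r₆)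
    (h₄ : 3 * r₄ = e * t₄) (h₆ : 2 * r₆ = e * t₆)
    (hm : 3 * m = padicValInt p W.minimalDiscriminantInt + t₄) (hn : 2 * n = padicValInt p W.minimalDiscriminantInt + t₆)
    (ht₄ : t₄ ≤ 2) (ht₆ : t₆ ≤ 1) (h5 : p = 5 → 0 < r₄ ∧ e < 9 ∧ e < r₄ + 4) (h7 : p = 7 → 0 < r₆ ∧ e < 13 ∧ e < r₆ + 6)
    (h50 : p = 5 → r₆ = 0) (h70 : p = 7 → r₄ = 0)
    {K : Type} [Field K] [NumberField K] {α : K} (hαe : α ^ e = (p : K))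
    (v' : HeightOneSpectrum (𝓞 K)) (hv' : ((p : ℕ) : 𝓞 K) ∈ v'.asIdeal)
    [CharZero (v'.adicCompletion K)] [LocallyCompactSpace (absoluteGaloisGroup (v'.adicCompletion K))]
    [Fact (¬ IsUnit ((p : ℕ) : integerC (v'.adicCompletion K)))]
    [IsAdicComplete (Ideal.span {((p : ℕ) : integerC (v'.adicCompletion K))}) (integerC (v'.adicCompletion K))]
    [CharZero (CompletedAlgClosure (v'.adicCompletion K))]
    (hp' : valuation (v'.adicCompletion K) ((p : ℕ) : v'.adicCompletion K) < 1) :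
    letI := LocalField.adicCompletionPadicAlgebra v' p hv'
    ∃ (E : WeierstrassCurve (v'.adicCompletion K)) (_ : E.IsElliptic) (C : VariableChange (v'.adicCompletion K)),
      C • (W.baseChange (v'.adicCompletion K)) = E ∧
      ∀ (eE : (k : ℕ) → geomTorsion E ((p ^ k : ℕ) : ℤ) → geomTorsion E ((p ^ k : ℕ) : ℤ) → AlgebraicClosure (v'.adicCompletion K))
        (hμ : ∀ k S T, eE k S T ^ (p ^ k) = 1) (hadd₁ : ∀ k S₁ S₂ T, eE k (S₁ + S₂) T = eE k S₁ T * eE k S₂ T)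
        (hadd₂ : ∀ k S T₁ T₂, eE k S (T₁ + T₂) = eE k S T₁ * eE k S T₂)
        (hgal : ∀ k (σ : absoluteGaloisGroup (v'.adicCompletion K)) (S T : geomTorsion E ((p ^ k : ℕ) : ℤ)), σ • eE k S T = eE k (σ • S) (σ • T))
        (hcompat : ∀ k (S T : geomTorsion E ((p ^ (k + 1) : ℕ) : ℤ)),
          eE k (torsionMulHom E (p ^ (k + 1)) (p ^ k) p (pow_succ p k).symm S) (torsionMulHom E (p ^ (k + 1)) (p ^ k) p (pow_succ p k).symm T) =
            eE (k + 1) S T ^ p)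
        (w : Valuation (v'.adicCompletion K) ℝ≥0) [w.Compatible] [E.IsIntegral w.integer]
        (ψ : C(absoluteGaloisGroup (v'.adicCompletion K), ℤ_[p])) (_hψ : ∀ σ τ, ψ (σ * τ) = ψ σ + ψ τ)
        (_hψlog : ∀ τ, (ψ τ : ℚ_[p]) = logCyclotomic (F := (v'.adicCompletion K)) p τ)
        (_heL : ∀ (c : ℤ_[p]) (S U : E.tateModule p),
          (weilContPairingPadic E (v'.adicCompletion K) p eE hμ hadd₁ hadd₂ hgal hcompat).toLin (c • S) U =
          twistHom (v'.adicCompletion K) p ((weilContPairingPadic E (v'.adicCompletion K) p eE hμ hadd₁ hadd₂ hgal hcompat).toLin S U) c)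
        (_healt : ∀ S : E.tateModule p, (weilContPairingPadic E (v'.adicCompletion K) p eE hμ hadd₁ hadd₂ hgal hcompat).toLin S S = 0)
        (_henondeg : ∀ S : E.tateModule p,
          (∀ U, (weilContPairingPadic E (v'.adicCompletion K) p eE hμ hadd₁ hadd₂ hgal hcompat).toLin S U = 0) → S = 0)
        (_hinj : (bdRPeriodRingData (F := (v'.adicCompletion K)) (p := p) hp').CupLogInjective (logCyclotomic p)
          (restrictedRationalTateRep E (v'.adicCompletion K) p))
        (_hde : ∀ η : contOneCocycles (restrictedTateRep E (v'.adicCompletion K) p).toTopRep,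
          (bdRPeriodRingData (F := (v'.adicCompletion K)) (p := p) hp').HasDualExp (logCyclotomic p)
            (restrictedRationalTateRep E (v'.adicCompletion K) p) fun σ => TateModule.toRational p (η.1 σ))
        (d : (bdRPeriodRingData (F := (v'.adicCompletion K)) (p := p) hp').FilZeroLine (restrictedRationalTateRep E (v'.adicCompletion K) p)),
        ∃ c : v'.adicCompletion K,
          ∀ (η : contOneCocycles (restrictedTateRep E (v'.adicCompletion K) p).toTopRep) (P : (E.baseChange (v'.adicCompletion K)).toAffine.Point),
            ((tatePairingPoint E (v'.adicCompletion K) p eE hμ hadd₁ hadd₂ hgal hcompat (oneCocycleClass _ η) P : ℤ_[p]) : ℚ_[p]) =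
              Algebra.trace ℚ_[p] (v'.adicCompletion K) (c * expStarCoord E hp' d η * padicLogPointFiniteExt w E p P) := by
  letI := LocalField.adicCompletionPadicAlgebra v' p hv'
  have hpr : p.Prime := hp.out
  have hp5 : 5 ≤ p := by rcases hp57 with rfl | rfl <;> norm_num
  have hp2 : p ≠ 2 := by omega
  have hr₄ : p = 5 → 0 < r₄ := fun h => (h5 h).1
  have hr₆ : p = 7 → 0 < r₆ := fun h => (h7 h).1
  -- §1 the cell numerology (verbatim from `…SupersingularCellsModels.isDeRham_adicCompletion_rat_of_model_of_ramifiedCapstone`)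
  set V := integralModelInt W with hV
  set vΔ := padicValInt p W.minimalDiscriminantInt with hvΔ
  obtain ⟨A, hA⟩ := pow_dvd_c₄_of_padicValRat_j_nonneg W p hj (m := m) (by omega)
  obtain ⟨B, hB⟩ := pow_dvd_c₆_of_padicValRat_j_nonneg W p hj (n := n) (by omega)
  have hΔ0 : V.Δ ≠ 0 := minimalDiscriminantInt_ne_zero W
  obtain ⟨dd, hd⟩ : (p : ℤ) ^ vΔ ∣ V.Δ := (padicValInt_dvd_iff _ _).2 (Or.inr le_rfl)
  have hpd : ¬ (p : ℤ) ∣ dd := by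
    rintro ⟨d', rfl⟩
    have : (p : ℤ) ^ (vΔ + 1) ∣ V.Δ := ⟨d', by rw [hd, pow_succ]; ring⟩
    rcases (padicValInt_dvd_iff _ _).1 this with h | h
    · exact hΔ0 h
    · have h' : vΔ + 1 ≤ vΔ := h
      omega
  -- the unit `64a³p^{t₄} + 432b²p^{t₆}` with `(a, b) = (−27A, −54B)`, as an integer and in `ℤ_p`
  have hid := unit_identity (q := (p : ℤ)) (by exact_mod_cast hpr.ne_zero) hA.symm hB.symm hd.symm V.c_relation hm hn
  have hz : ¬ (p : ℤ) ∣ -(6 ^ 12 * dd) := by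
    rw [dvd_neg]
    intro h
    rcases (Nat.prime_iff_prime_int.mp hpr).dvd_or_dvd h with h6 | h6
    · have hp6 : (p : ℤ) ∣ 6 := Int.Prime.dvd_pow' hpr h6
      rcases hp57 with rfl | rfl <;> norm_num at hp6
    · exact hpd h6
  have hU : ¬ (p : ℤ) ∣ 64 * (-27 * A) ^ 3 * (p : ℤ) ^ t₄ + 432 * (-54 * B) ^ 2 * (p : ℤ) ^ t₆ := by rwa [hid]
  have hunit : IsUnit (64 * (-27 * (A : ℤ_[p])) ^ 3 * (p : ℤ_[p]) ^ t₄ + 432 * (-54 * (B : ℤ_[p])) ^ 2 * (p : ℤ_[p]) ^ t₆) := by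
    have hu : IsUnit (((-(6 ^ 12 * dd) : ℤ)) : ℤ_[p]) := by
      rw [PadicInt.isUnit_iff]
      exact le_antisymm (PadicInt.norm_le_one _) (not_lt.1 fun h => hz ((PadicInt.norm_int_lt_one_iff_dvd _).1 h))
    rw [← hid] at hu
    push_cast at hu
    exact hu
  have hunit' : IsUnit (64 * (((-27 * A : ℤ) : ℤ_[p])) ^ 3 * (p : ℤ_[p]) ^ t₄ + 432 * (((-54 * B : ℤ) : ℤ_[p])) ^ 2 * (p : ℤ_[p]) ^ t₆) := by
    push_cast
    exact hunit
  have hα0 : α ≠ 0 := by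
    intro h0; rw [h0, zero_pow he.ne'] at hαe; exact (Nat.cast_ne_zero.2 hpr.ne_zero) hαe.symm
  -- §2 the `K`-model `S ≅ W ×_ℚ K`
  set S : WeierstrassCurve K := ⟨0, 0, 0, -27 * (V.c₄ : K) / (α ^ k) ^ 4, -54 * (V.c₆ : K) / (α ^ k) ^ 6⟩ with hS
  have hWK : W.baseChange K = V.map (Int.castRingHom K) := by
    rw [WeierstrassCurve.baseChange, ← map_integralModelInt W, WeierstrassCurve.map_map]
    congr 1
    exact RingHom.ext_int _ _
  have hc4K : (W.baseChange K).c₄ = (V.c₄ : K) := by rw [hWK, WeierstrassCurve.map_c₄, eq_intCast]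
  have hc6K : (W.baseChange K).c₆ = (V.c₆ : K) := by rw [hWK, WeierstrassCurve.map_c₆, eq_intCast]
  have h6 : (6 : K) ≠ 0 := by norm_num
  obtain ⟨C, hC⟩ := exists_variableChange_eq_short (L := K) two_ne_zero three_ne_zero (W.baseChange K)
    (u := α ^ k / 6) (div_ne_zero (pow_ne_zero _ hα0) h6)
  have e4 : -(V.c₄ : K) / (48 * (α ^ k / 6) ^ 4) = -27 * (V.c₄ : K) / (α ^ k) ^ 4 := by
    have : (α ^ k) ≠ 0 := pow_ne_zero _ hα0
    field_simp
    ring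
  have e6 : -(V.c₆ : K) / (864 * (α ^ k / 6) ^ 6) = -54 * (V.c₆ : K) / (α ^ k) ^ 6 := by
    have : (α ^ k) ≠ 0 := pow_ne_zero _ hα0
    field_simp
    ring
  have hC' : C • W.baseChange K = S := by rw [hC, hS, hc4K, hc6K, e4, e6]
  -- §3 over `F = K_{v′}`: `ϖ = α`, `D = (X^e − p, ϖ)`, `ψ : 𝒪_D → 𝒪_F`, the good model `W_D`
  obtain ⟨ϖ, hϖ⟩ : ∃ ϖ : v'.adicCompletion K, ϖ = algebraMap K (v'.adicCompletion K) α := ⟨_, rfl⟩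
  have hϖe : ϖ ^ e = (p : v'.adicCompletion K) := by rw [hϖ, ← map_pow, hαe, map_natCast]
  have hϖ0 : ϖ ≠ 0 := by rw [hϖ]; exact (_root_.map_ne_zero _).2 hα0
  obtain ⟨D, hD, hDroot⟩ := EisensteinRoot.exists_poly_eq_X_pow_sub_C hp' he hϖe
  have hroot := D.root_pow_eq_of_poly_eq hD
  obtain ⟨ψ₀, hψ₀⟩ : ∃ ψ₀ : EisensteinRoot.CoeffDisc D →+* LTCoeff (v'.adicCompletion K),
      ∀ c, algebraMap (LTCoeff (v'.adicCompletion K)) (v'.adicCompletion K) (ψ₀ c) = EisensteinRoot.CoeffDisc.toF D c := by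
    obtain ⟨β, hβ⟩ := EisensteinRoot.exists_coeffToLTCoeff D
    exact ⟨β.comp (EisensteinRoot.CoeffDisc.of D).symm.toRingHom, fun c => hβ _⟩
  haveI : CharP 𝓀[v'.adicCompletion K] p := charP_residueField_of_valuation_lt_one hp'
  -- the model over `𝒪_D` (both presentations) and its reduction data
  set WD : WeierstrassCurve D.Coeff := ⟨0, 0, 0, AdjoinRoot.of D.poly ((-27 * A : ℤ) : ℤ_[p]) * AdjoinRoot.root D.poly ^ r₄,
      AdjoinRoot.of D.poly ((-54 * B : ℤ) : ℤ_[p]) * AdjoinRoot.root D.poly ^ r₆⟩ with hWD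
  set Wm : WeierstrassCurve (EisensteinRoot.CoeffDisc D) := WD.map (EisensteinRoot.CoeffDisc.of D).toRingHom with hWm
  have hWmψ : Wm.map ψ₀ = WD.map (ψ₀.comp (EisensteinRoot.CoeffDisc.of D).toRingHom) := by rw [hWm, WeierstrassCurve.map_map]
  have hΔ : IsUnit (Wm.map ψ₀).Δ := by
    rw [hWmψ]; exact AinfTop.isUnit_Δ_map_model (F := v'.adicCompletion K) hD (ψ₀.comp (EisensteinRoot.CoeffDisc.of D).toRingHom) _ _ h₄ h₆ hunit'
  have hHasse : ((Wm.map ψ₀).map (AinfTop.redCoeff (v'.adicCompletion K))).hasseCoeff p = 0 := by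
    rw [hWmψ]; exact AinfTop.hasseCoeff_red_map_model_eq_zero hD (ψ₀.comp (EisensteinRoot.CoeffDisc.of D).toRingHom) _ _ hp57 hr₄ hr₆
  haveI hEll : (AinfTop.curveFO (v'.adicCompletion K) (Wm.map ψ₀)).IsElliptic := AinfTop.isElliptic_curveFO _ hΔ
  haveI hEllC : (curveOver (CompletedAlgClosure (v'.adicCompletion K)) (Wm.map ψ₀)).IsElliptic := AinfTop.isElliptic_curveOverC_O hΔ
  -- `E := (W_D ⊗_ψ 𝒪_F) ⊗ F = W_D ⊗_{𝒪_D} F = S ⊗ F = (C ⊗ F) • (W ⊗ F)`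
  have hEWD : AinfTop.curveFO (v'.adicCompletion K) (Wm.map ψ₀) = WD.map (EisensteinRoot.Coeff.toF D) := by
    rw [hWm]; exact AinfRamTop.curveFO_map_of_map_ψ WD ψ₀ hψ₀
  have hSF : S.baseChange (v'.adicCompletion K) = WD.map (EisensteinRoot.Coeff.toF D) := by
    rw [hWD, map_model_toF, hDroot]
    have hp4 : (ϖ ^ k) ^ 4 * ϖ ^ r₄ = (p : v'.adicCompletion K) ^ m := by
      rw [← pow_mul, ← pow_add, show k * 4 + r₄ = e * m by omega, pow_mul, hϖe]
    have hp6 : (ϖ ^ k) ^ 6 * ϖ ^ r₆ = (p : v'.adicCompletion K) ^ n := by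
      rw [← pow_mul, ← pow_add, show k * 6 + r₆ = e * n by omega, pow_mul, hϖe]
    have hc4F : ((V.c₄ : ℤ) : v'.adicCompletion K) = (ϖ ^ k) ^ 4 * ϖ ^ r₄ * (A : v'.adicCompletion K) := by
      rw [hp4, hA]; push_cast; ring
    have hc6F : ((V.c₆ : ℤ) : v'.adicCompletion K) = (ϖ ^ k) ^ 6 * ϖ ^ r₆ * (B : v'.adicCompletion K) := by
      rw [hp6, hB]; push_cast; ring
    have hϖk : ϖ ^ k ≠ 0 := pow_ne_zero _ hϖ0
    have ha4 : algebraMap K (v'.adicCompletion K) (-27 * (V.c₄ : K) / (α ^ k) ^ 4) =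
        zpToF hp' ((-27 * A : ℤ) : ℤ_[p]) * ϖ ^ r₄ := by
      rw [map_div₀, map_mul, map_neg, map_ofNat, map_intCast, map_pow, map_pow, ← hϖ, map_intCast, hc4F]
      field_simp
      push_cast
      ring
    have ha6 : algebraMap K (v'.adicCompletion K) (-54 * (V.c₆ : K) / (α ^ k) ^ 6) =
        zpToF hp' ((-54 * B : ℤ) : ℤ_[p]) * ϖ ^ r₆ := by
      rw [map_div₀, map_mul, map_neg, map_ofNat, map_intCast, map_pow, map_pow, ← hϖ, map_intCast, hc6F]
      field_simp
      push_cast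
      ring
    exact WeierstrassCurve.ext (map_zero _) (map_zero _) (map_zero _) ha4 ha6
  have hWKF : (W.baseChange K).baseChange (v'.adicCompletion K) = W.baseChange (v'.adicCompletion K) :=
    (W.map_baseChange (IsScalarTower.toAlgHom ℚ K (v'.adicCompletion K)))
  have hCE : (C.map (algebraMap K (v'.adicCompletion K))) • W.baseChange (v'.adicCompletion K) =
      AinfTop.curveFO (v'.adicCompletion K) (Wm.map ψ₀) := by
    rw [hEWD, ← hSF, ← hC', ← hWKF]
    simp only [WeierstrassCurve.baseChange, WeierstrassCurve.map_variableChange]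
  -- §4 the CM fibre `E₀` and its data
  set a : ℤ := -27 * A with ha
  set b : ℤ := -54 * B with hb
  set E₀ : WeierstrassCurve ℤ := ⟨0, 0, 0, if r₄ = 0 then a else 0, if r₆ = 0 then b else 0⟩ with hE₀
  have hWmE : Wm = ⟨0, 0, 0, algebraMap ℤ (EisensteinRoot.CoeffDisc D) a * EisensteinRoot.CoeffDisc.of D (AdjoinRoot.root D.poly) ^ r₄,
      algebraMap ℤ (EisensteinRoot.CoeffDisc D) b * EisensteinRoot.CoeffDisc.of D (AdjoinRoot.root D.poly) ^ r₆⟩ := by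
    rw [hWm, hWD]
    refine WeierstrassCurve.ext (map_zero _) (map_zero _) (map_zero _) ?_ ?_ <;>
    · simp only [WeierstrassCurve.map, RingEquiv.toRingHom_eq_coe, RingHom.coe_coe, map_mul, map_pow, map_intCast, eq_intCast]
  have hWE : Wm.map (Ideal.Quotient.mk (Ideal.span {EisensteinRoot.CoeffDisc.of D (AdjoinRoot.root D.poly)})) =
      (E₀.map (algebraMap ℤ (EisensteinRoot.CoeffDisc D))).map
        (Ideal.Quotient.mk (Ideal.span {EisensteinRoot.CoeffDisc.of D (AdjoinRoot.root D.poly)})) := by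
    rw [hWmE, hE₀]; exact map_explicitModel_eq_map_cmFibre D a b r₄ r₆
  -- `p ∤ Δ(E₀)` and Hasse(E₀) = 0, by cases on the cell prime
  have hE₀Δ : ¬ (p : ℤ) ∣ E₀.Δ ∧ (E₀.map (Int.castRingHom (ZMod p))).hasseCoeff p = 0 := by
    have hmap : E₀.map (Int.castRingHom (ZMod p)) =
        ⟨0, 0, 0, ((if r₄ = 0 then a else 0 : ℤ) : ZMod p), ((if r₆ = 0 then b else 0 : ℤ) : ZMod p)⟩ := by
      rw [hE₀]; simp only [WeierstrassCurve.map, map_zero, eq_intCast]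
    rcases hp57 with rfl | rfl
    · -- `p = 5`: `r₄ > 0`, `r₆ = 0`, `t₆ = 0`, `t₄ > 0`; `E₀ = y² = x³ + b`, `Δ(E₀) = −432 b²`, Hasse `= 32·0`
      have hr4 : r₄ ≠ 0 := (hr₄ rfl).ne'
      have hr6 : r₆ = 0 := h50 rfl
      have ht6 : t₆ = 0 := by
        rcases Nat.eq_zero_or_pos t₆ with h | h
        · exact h
        · exfalso; have := Nat.mul_pos he h; omega
      have ht4 : t₄ ≠ 0 := by
        intro h; rw [h, mul_zero] at h₄; omega
      have hX : ((5 : ℕ) : ℤ) ∣ 64 * (-27 * A) ^ 3 * ((5 : ℕ) : ℤ) ^ t₄ := Dvd.dvd.mul_left (dvd_pow_self _ ht4) _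
      have hY : ¬ ((5 : ℕ) : ℤ) ∣ 432 * (-54 * B) ^ 2 := by
        intro hY; apply hU; rw [ht6, pow_zero, mul_one]; exact dvd_add hX hY
      refine ⟨?_, ?_⟩
      · have hΔE : E₀.Δ = -(432 * (-54 * B) ^ 2) := by
          rw [hE₀]
          simp only [if_neg hr4, if_pos hr6, hb, WeierstrassCurve.Δ, WeierstrassCurve.b₂, WeierstrassCurve.b₄, WeierstrassCurve.b₆,
            WeierstrassCurve.b₈]
          ring
        rw [hΔE, dvd_neg]; exact hY
      · rw [hmap, hasseCoeff_five_short, if_neg hr4, Int.cast_zero, mul_zero]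
    · -- `p = 7`: `r₄ = 0`, `r₆ > 0`, `t₄ = 0`, `t₆ > 0`; `E₀ = y² = x³ + a x`, `Δ(E₀) = −64 a³`, Hasse `= 192·0`
      have hr6 : r₆ ≠ 0 := (hr₆ rfl).ne'
      have hr4 : r₄ = 0 := h70 rfl
      have ht4 : t₄ = 0 := by
        rcases Nat.eq_zero_or_pos t₄ with h | h
        · exact h
        · exfalso; have := Nat.mul_pos he h; omega
      have ht6 : t₆ ≠ 0 := by
        intro h; rw [h, mul_zero] at h₆; omega
      have hX : ((7 : ℕ) : ℤ) ∣ 432 * (-54 * B) ^ 2 * ((7 : ℕ) : ℤ) ^ t₆ := Dvd.dvd.mul_left (dvd_pow_self _ ht6) _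
      have hY : ¬ ((7 : ℕ) : ℤ) ∣ 64 * (-27 * A) ^ 3 := by
        intro hY; apply hU; rw [ht4, pow_zero, mul_one]; exact dvd_add hY hX
      refine ⟨?_, ?_⟩
      · have hΔE : E₀.Δ = -(64 * (-27 * A) ^ 3) := by
          rw [hE₀]
          simp only [if_pos hr4, if_neg hr6, ha, WeierstrassCurve.Δ, WeierstrassCurve.b₂, WeierstrassCurve.b₄, WeierstrassCurve.b₆,
            WeierstrassCurve.b₈]
          ring
        rw [hΔE, dvd_neg]; exact hY
      · rw [hmap, hasseCoeff_seven_short, if_neg hr6, Int.cast_zero, mul_zero]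
  obtain ⟨hΔ₀, hA₀⟩ := hE₀Δ
  have hE₀Δ0 : E₀.Δ ≠ 0 := fun h => hΔ₀ (h ▸ dvd_zero _)
  haveI : (E₀.map (Int.castRingHom ℚ_[p])).IsElliptic :=
    ⟨by rw [WeierstrassCurve.map_Δ, isUnit_iff_ne_zero, eq_intCast]; exact Int.cast_ne_zero.mpr hE₀Δ0⟩
  haveI : (E₀.map (Int.castRingHom (ZMod p))).IsElliptic :=
    ⟨by rw [WeierstrassCurve.map_Δ, isUnit_iff_ne_zero, eq_intCast, Ne, ZMod.intCast_zmod_eq_zero_iff_dvd]; exact_mod_cast hΔ₀⟩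
  haveI : (curveOver (CompletedAlgClosure (v'.adicCompletion K)) E₀).IsElliptic := AinfTop.isElliptic_curveOverC E₀ hE₀Δ0
  -- §5 (N1′) at a Tate-module witness, and `N = e`
  have hθ : Function.Surjective (WittVector.fontaineTheta (integerC (v'.adicCompletion K)) p) := surjective_fontaineTheta_integerC hp'
  obtain ⟨τ, hτ1, -⟩ :=
    AinfTop.exists_tatePtO_norm_p_lt_norm_pow_model hD (ψ₀.comp (EisensteinRoot.CoeffDisc.of D).toRingHom) ((-27 * A : ℤ) : ℤ_[p])
      ((-54 * B : ℤ) : ℤ_[p]) hp57 h₄ h₆ hunit' hr₄ hr₆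
  have hN1seq : ∀ {t : ℕ → (maxNilIdealC (v'.adicCompletion K)).toIdeal} (ht0 : (t 0 : CBall (v'.adicCompletion K)) = 0)
      (htp : ∀ n, AinfRamTop.mulPC Wm (t (n + 1)) = t n),
      (t 1 : CBall (v'.adicCompletion K)) ≠ 0 → AinfRamTop.omegaPeriod Wm hθ t ht0 htp ≠ 0 := by
    intro t ht0 htp h1
    rcases hp57 with rfl | rfl
    · obtain ⟨hr, he', her⟩ := h5 rfl
      exact AinfRamTop.omegaPeriod_model_five_ne_zero_of_lt hD _ _ hr he' her h₄ h₆ hunit' ht0 htp h1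
    · obtain ⟨hr, he', her⟩ := h7 rfl
      exact AinfRamTop.omegaPeriod_model_seven_ne_zero_of_lt hD _ _ hr he' her h₄ h₆ hunit' ht0 htp h1
  have hN1 := AinfRamTop.exists_omegaPeriodHomO_ne_zero Wm ψ₀ (hθ := hθ) (hψ := hψ₀) hN1seq ⟨τ, hτ1⟩
  have hNe : D.e ≤ e := (D.e_eq_of_poly_eq hD).le
  -- §6 assembly: T5-D for the model
  refine ⟨AinfTop.curveFO (v'.adicCompletion K) (Wm.map ψ₀), hEll, C.map (algebraMap K (v'.adicCompletion K)), hCE, ?_⟩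
  intro eE hμ hadd₁ hadd₂ hgal hcompat w _ _ ψ hψ hψlog heL healt henondeg hinj hde d
  exact TransportedReciprocityAllPoints.exists_const_tatePairingPoint_eq_trace_mul_padicLog v' hp' D Wm ψ₀ hψ₀ hp2 hΔ hHasse eE hμ hadd₁ hadd₂
    hgal hcompat w hp5 E₀ hWE hΔ₀ hA₀ hNe hN1 ψ hψ hψlog heL healt henondeg hinj hde d

/-- ★★★ **Kato's formula at all points of the good model, the three potentially SUPERSINGULAR K★ cells.** For a globally minimal `W/ℚ` with
`p ∈ {5, 7}`, additive reduction at `p`, no `Iₙ*` fibre at `p`, `4 < ord_p Δ_min` and NOT `(p = 5 ↔ ord_p Δ_min = 9)` — the cells `(5; IV*)`,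
`(5; II*)`, `(7; III*)` — a number field `K ∋ α` with `α^e = p`, `e` from the cell table (`8 ↦ 3`, `10 ↦ 6`, `9 ↦ 4`), and a place `v′ ∋ p` with the
packet keys: the conclusion of `exists_goodModel_formula_of_numerology` (numerology `(3; 2,3,4; 1,0; 1,0)`, `(6; 5,4,5; 4,0; 2,0)`, `(4; 3,3,5; 0,2; 0,1)`
as in `…SupersingularCellsExplicit.isDeRham_supersingularCells_of_explicitCapstone`). This is every MODEL-SIDE input of the socket
`stub_localFormulaSupersingularCells` of skeleton v9; the transport to `W ⊗ K_{v′}` (T5-E) is not done here.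
[cite: Kato1993LNM1553, Ch. II Thm. 1.4.1 (3)–(4), Lemma 1.4.3] [cite: SilvermanATAEC1994, IV Table 4.1] [cite: SilvermanAEC2009, VII.5.5 and IV.7.5] -/
theorem exists_goodModel_formula_of_ssCell (hp57 : p = 5 ∨ p = 7) (hadd : Addv W p)
    (hIstar : ∀ (v : HeightOneSpectrum ℤ) (n : ℕ), natGenerator v = p → W.kodairaSymbolAt v ≠ KodairaSymbol.Istar n)
    (h4 : 4 < padicValInt p W.minimalDiscriminantInt) {e : ℕ}
    (htab : p = 5 ∧ padicValInt p W.minimalDiscriminantInt = 8 ∧ e = 3 ∨ p = 5 ∧ padicValInt p W.minimalDiscriminantInt = 10 ∧ e = 6 ∨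
      p = 7 ∧ padicValInt p W.minimalDiscriminantInt = 9 ∧ e = 4)
    {K : Type} [Field K] [NumberField K] {α : K} (hαe : α ^ e = (p : K))
    (v' : HeightOneSpectrum (𝓞 K)) (hv' : ((p : ℕ) : 𝓞 K) ∈ v'.asIdeal)
    [CharZero (v'.adicCompletion K)] [LocallyCompactSpace (absoluteGaloisGroup (v'.adicCompletion K))]
    [Fact (¬ IsUnit ((p : ℕ) : integerC (v'.adicCompletion K)))]
    [IsAdicComplete (Ideal.span {((p : ℕ) : integerC (v'.adicCompletion K))}) (integerC (v'.adicCompletion K))]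
    [CharZero (CompletedAlgClosure (v'.adicCompletion K))]
    (hp' : valuation (v'.adicCompletion K) ((p : ℕ) : v'.adicCompletion K) < 1) :
    letI := LocalField.adicCompletionPadicAlgebra v' p hv'
    ∃ (E : WeierstrassCurve (v'.adicCompletion K)) (_ : E.IsElliptic) (C : VariableChange (v'.adicCompletion K)),
      C • (W.baseChange (v'.adicCompletion K)) = E ∧
      ∀ (eE : (k : ℕ) → geomTorsion E ((p ^ k : ℕ) : ℤ) → geomTorsion E ((p ^ k : ℕ) : ℤ) → AlgebraicClosure (v'.adicCompletion K))
        (hμ : ∀ k S T, eE k S T ^ (p ^ k) = 1) (hadd₁ : ∀ k S₁ S₂ T, eE k (S₁ + S₂) T = eE k S₁ T * eE k S₂ T)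
        (hadd₂ : ∀ k S T₁ T₂, eE k S (T₁ + T₂) = eE k S T₁ * eE k S T₂)
        (hgal : ∀ k (σ : absoluteGaloisGroup (v'.adicCompletion K)) (S T : geomTorsion E ((p ^ k : ℕ) : ℤ)), σ • eE k S T = eE k (σ • S) (σ • T))
        (hcompat : ∀ k (S T : geomTorsion E ((p ^ (k + 1) : ℕ) : ℤ)),
          eE k (torsionMulHom E (p ^ (k + 1)) (p ^ k) p (pow_succ p k).symm S) (torsionMulHom E (p ^ (k + 1)) (p ^ k) p (pow_succ p k).symm T) =
            eE (k + 1) S T ^ p)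
        (w : Valuation (v'.adicCompletion K) ℝ≥0) [w.Compatible] [E.IsIntegral w.integer]
        (ψ : C(absoluteGaloisGroup (v'.adicCompletion K), ℤ_[p])) (_hψ : ∀ σ τ, ψ (σ * τ) = ψ σ + ψ τ)
        (_hψlog : ∀ τ, (ψ τ : ℚ_[p]) = logCyclotomic (F := (v'.adicCompletion K)) p τ)
        (_heL : ∀ (c : ℤ_[p]) (S U : E.tateModule p),
          (weilContPairingPadic E (v'.adicCompletion K) p eE hμ hadd₁ hadd₂ hgal hcompat).toLin (c • S) U =
          twistHom (v'.adicCompletion K) p ((weilContPairingPadic E (v'.adicCompletion K) p eE hμ hadd₁ hadd₂ hgal hcompat).toLin S U) c)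
        (_healt : ∀ S : E.tateModule p, (weilContPairingPadic E (v'.adicCompletion K) p eE hμ hadd₁ hadd₂ hgal hcompat).toLin S S = 0)
        (_henondeg : ∀ S : E.tateModule p,
          (∀ U, (weilContPairingPadic E (v'.adicCompletion K) p eE hμ hadd₁ hadd₂ hgal hcompat).toLin S U = 0) → S = 0)
        (_hinj : (bdRPeriodRingData (F := (v'.adicCompletion K)) (p := p) hp').CupLogInjective (logCyclotomic p)
          (restrictedRationalTateRep E (v'.adicCompletion K) p))
        (_hde : ∀ η : contOneCocycles (restrictedTateRep E (v'.adicCompletion K) p).toTopRep,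
          (bdRPeriodRingData (F := (v'.adicCompletion K)) (p := p) hp').HasDualExp (logCyclotomic p)
            (restrictedRationalTateRep E (v'.adicCompletion K) p) fun σ => TateModule.toRational p (η.1 σ))
        (d : (bdRPeriodRingData (F := (v'.adicCompletion K)) (p := p) hp').FilZeroLine (restrictedRationalTateRep E (v'.adicCompletion K) p)),
        ∃ c : v'.adicCompletion K,
          ∀ (η : contOneCocycles (restrictedTateRep E (v'.adicCompletion K) p).toTopRep) (P : (E.baseChange (v'.adicCompletion K)).toAffine.Point),
            ((tatePairingPoint E (v'.adicCompletion K) p eE hμ hadd₁ hadd₂ hgal hcompat (oneCocycleClass _ η) P : ℤ_[p]) : ℚ_[p]) =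
              Algebra.trace ℚ_[p] (v'.adicCompletion K) (c * expStarCoord E hp' d η * padicLogPointFiniteExt w E p P) := by
  have hp5 : 5 ≤ p := by rcases hp57 with rfl | rfl <;> norm_num
  have hgen : natGenerator (placeOf p) = p := congrArg Subtype.val ((primesEquiv (R := ℤ)).apply_symm_apply ⟨p, hp.out⟩)
  obtain ⟨hj, -⟩ := padicValRat_j_nonneg_and_mem_of_starred W p hp5 hadd (fun n => hIstar (placeOf p) n hgen) h4
  rcases htab with ⟨rfl, h8, rfl⟩ | ⟨rfl, h10, rfl⟩ | ⟨rfl, h9, rfl⟩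
  · exact exists_goodModel_formula_of_numerology W 5 (Or.inl rfl) hj (e := 3) (k := 2) (m := 3) (n := 4) (r₄ := 1) (r₆ := 0) (t₄ := 1)
      (t₆ := 0) (by norm_num) (by norm_num) (by norm_num) (by norm_num) (by norm_num) (by rw [h8]) (by rw [h8]) (by norm_num) (by norm_num)
      (fun _ => ⟨by norm_num, by norm_num, by norm_num⟩) (fun h => by norm_num at h) (fun _ => rfl) (fun h => by norm_num at h) hαe v' hv' hp'
  · exact exists_goodModel_formula_of_numerology W 5 (Or.inl rfl) hj (e := 6) (k := 5) (m := 4) (n := 5) (r₄ := 4) (r₆ := 0) (t₄ := 2)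
      (t₆ := 0) (by norm_num) (by norm_num) (by norm_num) (by norm_num) (by norm_num) (by rw [h10]) (by rw [h10]) (by norm_num) (by norm_num)
      (fun _ => ⟨by norm_num, by norm_num, by norm_num⟩) (fun h => by norm_num at h) (fun _ => rfl) (fun h => by norm_num at h) hαe v' hv' hp'
  · exact exists_goodModel_formula_of_numerology W 7 (Or.inr rfl) hj (e := 4) (k := 3) (m := 3) (n := 5) (r₄ := 0) (r₆ := 2) (t₄ := 0)
      (t₆ := 1) (by norm_num) (by norm_num) (by norm_num) (by norm_num) (by norm_num) (by rw [h9]) (by rw [h9]) (by norm_num) (by norm_num)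
      (fun h => by norm_num at h) (fun _ => ⟨by norm_num, by norm_num, by norm_num⟩) (fun h => by norm_num at h) (fun _ => rfl) hαe v' hv' hp'

end Summit.BirchSwinnertonDyer.BirchSwinnertonDyer.Theorems.StarredOptimalManinUnitFiveSevenGoodModelFormula

end
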